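import Summits.QuantumFields.YangMills.Theorems.BalabanUVNodesN12RootTransporterAtRecordLam
import Summits.QuantumFields.YangMills.Theorems.BalabanUVNodesN12TowerForestLam
import Literature.MathematicalPhysics.QuantumFieldTheory.Balaban1983to89.B15Prop1GaugeLetterLocOfForestPackageB
import HarnessLib

/-!
# BalabanUVNodes ∕ N12 — THE LOCALISED GAUGE LETTER (σ)_N AT THE ENDPOINT's OBJECTS FOR PRINT's DATUM `Λ(Z) = lamBondsSeq (maxDomT ν.M₁ Z) k` ([Balaban1984PropagatorsII] (2.3)), FOREST-FREE
# AND `hT`-FREE: dag-n12-w3's capstone `…N12GaugeLetterLocAtRecord.exists_gaugeLetterLoc_atRecord` RE-KEYED at print's datum — the rooted tower forest at PRINT roots (this seat's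
# `…N12TowerForestLam`), the graded root-transporter letter on the bonds TOUCHING `Ω₁(Z)` (`…N12RootTransporterAtRecordLam`, crossing bonds through the outward connector — the lane's
# LOCATED-2) and the lane's bond-datum producer `B15Prop1GaugeLetterLocOfForestPackageB` (✓p775953) composed BY NAME — O1 module (4) of the gauge-letter chain (dag-n12-d CEDE ∕ dag-lead
# WORDS 426∕427, pub-ymgap INBOX 2026-08-30)

[Balaban1984PropagatorsII] = «[II]», (2.3) p. 224 (print's `Λ_j`; at `Z`'s maximal sequence the bonds with BOTH end-points off `Ω₁(Z)` are the pinned level-`0` members, the CROSSING bonds are free);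
[Balaban1985Variational] = «[15]», (2)–(4) p. 278, Thm 1 (8) p. 279, (16)–(18) p. 280; [Balaban1985RegularSpaces] = «[6]», (1.7) p. 77, (1.19) p. 79; [Balaban1988Convergent] = «[III]», (2.2) p. 255,
(2.11)–(2.13) pp. 256–257, (2.16) p. 257; [Balaban1987RG1] = «[RG1]», (0.4) p. 253; [Balaban1989LargeFieldI], (1.74) p. 192, Prop. 1 p. 194.

Cell `pub-ymgap` (HUMAN RULINGS D-0062 ∕ D-0149), lane `pub-ymgap-dag-n12-c` g37 (R134 seat (a), N12 = [B15], s1, lane owner; O1 by dag-n12-d's CEDE and dag-lead WORDS 426∕427); `--kind proof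
--supports` K1⁹ `stmt-QuantumFields-27364` `--as helper`; count-neutral.  THEOREMS ONLY (0 `def`, 0 `instance`, 0 `sorry`); composition BY NAME of `…N12TowerForestLam.exists_towerForest_rooted_lamBondsSeq`
((F2) at `Λ`'s tower sites, words, (TOWER)(LEN)(DISP)(ROOTBLK), (Cov), (CENTRE)ᴸᵃᵐ), `…N12TowerForestLam.centre_mem_rootSetLam`, `…N12RootTransporterAtRecordLam.rootTransporter_atRecord_lamBondsSeq_graded_touching_of_plaqSmall`,
`…N12RootTransporterBj.theta_mono_of_nonneg`, this lane's `B15DeterminingSetsBEndpoints.mem_lamBondsSeq_maxDomT_of_embIter_not_mem` (level `0`: both end-points off `Ω₁(Z)` ⇒ member) and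
`B15Prop1GaugeLetterLocOfForestPackageB.exists_gaugeLetterLoc_atRecord_of_forestPackage` (the (σ)_N producer over a bond datum `𝔅`, with `Ωx`, `h𝔅0`, `hcov` over `𝔅`, Cin on all of `N`).
The STATEMENT is the parent's text (tree bytes, `work/gen_glatrecord_lam.py`) with: `hmin ↦ IsMinimizerB … (lamBondsSeq (maxDomT ν.M₁ Z) k) …`; `ha`, `hWj` on print members; `hu` on print
members; Cin on ALL of `N` (the parent: `inputs 𝐁_k(Z) ∩ N`); and the ONE SUBSTANTIVE CHANGE (LOCATED-2): the graded plaquette letter `hSΩ` is displayed on the bonds inside the ONE-LAYER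
EXTENSION `Ωx(Z) = {end-points of the bonds touching Ω₁(Z)}` instead of the bonds inside `Ω₁(Z)` — because a crossing bond is NOT pinned at print's datum and its transporter runs through the
outward connector and the `Λ₀`-links INSIDE the outside neighbour block.  DECL MAP (old → new): `N12GaugeLetterLocAtRecord.exists_gaugeLetterLoc_atRecord ↦
N12GaugeLetterLocAtRecordLam.exists_gaugeLetterLoc_atRecord_lamBondsSeq`.

WHY (the two print-datum facts the composition needs beyond the parents').  (i) On a bond with BOTH end-points off `Ω₁(Z)` the minimiser IS pinned (print's `Λ₀` at `Z`'s maximal sequence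
contains it: both centres off `Ω₁`), both end-points are print roots (`Γ₀`-sites), and `hT` is the one-letter word along the bond with `g := U₀(b) = V₀(b)`, `dist1 g ≤ δ₁ ≤ m·δ₁`, transport
error `0`.  (ii) On a CROSSING bond the two roots are the `Γ_J`-centre of the inside end and the outside end itself; the chain between them is `…N12BjRootChainsLam.exists_rootChain_lamBondsSeq_graded_touching`
(the outward connector of level `1` + `Λ₀`-links), read through the graded `hT` of `…N12RootTransporterAtRecordLam` — whose plaquette boxes sit around bonds of `Ωx(Z)`, whence the displayed `hSΩ`.

HONEST FRAMING.  Composition by name; the minimiser ([15] Thm 1 ∕ the lane's (E)), the region datum, every plaquette estimate ((1.7)∕(2.14) for `U₀`, [Balaban1985Averaging] Prop. 1–2 for the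
iterated averages), the datum letter and the numerics stay HYPOTHESES; nothing of Bałaban's is asserted or refuted; count-neutral helper (`--supports 27364`); N12 NOT discharged; K0⁷∕K1⁹ NOT
closed; counts of record unmoved (typed 28∕28 · discharged 8∕27); one finite 𝕋⁴ programme at fixed ε — R4 closes the conditional rung `BalabanLadder.UV` only; the Yang–Mills mass gap (Clay)
is NOT proved by any of this; nothing continuum ∕ ℝ⁴ ∕ OS.
-/

noncomputable section

open scoped Matrix.Norms.L2Operator BigOperators

namespace Summit.QuantumFields.YangMills.BalabanUVNodes.N12GaugeLetterLocAtRecordLam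

open Literature.MathematicalPhysics.QuantumFieldTheory.Balaban1983to89
open T4Continuum GaugeField B15DeterminingSets B15DeterminingSetsB BlockAveraging
open T4CubeChartGnomonic (SU2)
open B16Sect1Backgrounds (toMS)
open T4AxialGaugeSmallField (boxPlaqs)
open B14.Eq213MaximalDomains (side)
open B14.Eq213DetSet (Bj Bj_zero maxDomT)
open B14.Eq22Determines (blockIter)
open B5Eq118OneStroke (iterBlockOf)
open ExpMeanLog (deltaSU)
open Literature.MathematicalPhysics.QuantumFieldTheory.BalabanImbrieJaffe1984to88.BIJ85Eq453GaugeField (qsstarGIter0)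
open B15DeterminingSetsBEndpoints (mem_lamBondsSeq_maxDomT_of_embIter_not_mem)
open B15Prop1GaugeLetterLocOfForestPackageB (exists_gaugeLetterLoc_atRecord_of_forestPackage)
open Summit.QuantumFields.YangMills.BalabanUVNodes.N12TowerForestLam (exists_towerForest_rooted_lamBondsSeq centre_mem_rootSetLam)
open Summit.QuantumFields.YangMills.BalabanUVNodes.N12RootTransporterBj (theta_mono_of_nonneg)
open Summit.QuantumFields.YangMills.BalabanUVNodes.N12RootTransporterAtRecordLam (rootTransporter_atRecord_lamBondsSeq_graded_touching_of_plaqSmall)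

/-- ★★★ **THE LOCALISED GAUGE LETTER (σ)_N AT THE RECORD FOR PRINT's DATUM, FOREST-FREE AND `hT`-FREE.**  Objects of the endpoint: torus `F.P Kt`, numerics `ν` (`2 ≤ ν.M₁`, cover divisibility at
level `k`), `1 ≤ k ≤ m + K`, `Ω₁(Z) = maxDomT ν.M₁ Z 1`, print's datum `Λ(Z) = lamBondsSeq (maxDomT ν.M₁ Z) k`; a `k`-field `W` that is `ρn`-near `1` on a bond set `𝒞` generating the data
`M˙(Q_k^{s*}W)`; a (2.12) minimiser `U₀` of these data ON `Λ(Z)` in NODE 00's class (`IsMinimizerB`); the neighbourhood `N` with dag-n12-w6's geometry letters `hGN`, `hN1`.  DISPLAYED ESTIMATES: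
ONE graded root-free plaquette letter for `U₀` (`PlaqSmallOn S εP U₀`, boxes in LEVEL FORM around the sources of the bonds INSIDE THE ONE-LAYER EXTENSION `Ωx(Z)` of `Ω₁(Z)` — LOCATED-2: the
crossing bonds are not pinned and are read as two-root bonds); the plaquette letter `a_j` on the iterated averages `M^j(U₀)` near the PRINT-member segments with budgets `θ`; the datum letter `hWj`
on PRINT members (`0 ≤ δ₁`); no wrapping `2ℓ_k + 1 + m·L^k < sitesPerDir 0`.  CONCLUSION: a gauge `σ` with the root letter `hu` on `Λ(Z)` (trivial at the tower sites of every print member), and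
`‖↑((U₀^σ) b) − 1‖ ≤ max ρn (((2ℓ_k+1+m·L^k)²∕4)·εP + m·θ_k + m·δ₁)` on the four bonds of every `Ω₁(Z)`-touching plaquette and on EVERY bond of `N` (`ℓ_k = Σ_{i≤k}(d(Lⁱ−1)∕2+1)`,
`m = 3·d·(L−1)∕2 + 5`).  Inside: `…N12TowerForestLam` (roots = `Γ`-centres), graded budgets, `…N12RootTransporterAtRecordLam` (touching bonds), the pinned one-letter transporter on the bonds off
`Ω₁(Z)`, and the lane's producer `B15Prop1GaugeLetterLocOfForestPackageB`. [cite: Balaban1984PropagatorsII, (2.3) p.224; Balaban1985Variational, (3)–(4) p.278, Thm 1 (8) p.279, (16)–(18) p.280; Balaban1985RegularSpaces, (1.7) p.77, (1.19) p.79; Balaban1988Convergent, (2.2) p.255, (2.12)–(2.13) pp.256–257, (2.16) p.257; Balaban1987RG1, (0.4) p.253] -/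
theorem exists_gaugeLetterLoc_atRecord_lamBondsSeq {F : T4Family} (ν : Node00.Stage7Numerics) (Kt : ℕ) {k : ℕ} (hk0 : 0 < k) (hk : k ≤ (F.P Kt).m + (F.P Kt).K)
    (hM2 : 2 ≤ ν.M₁) (hdiv : side (F.P Kt).L ν.M₁ k ∣ (F.P Kt).sitesPerDir 0) (Z : Set (Site (F.P Kt) 0))
    -- no wrapping, at the caps `ℓ_k`, `m·L^k`
    (hN : 2 * (∑ i ∈ Finset.range (k + 1), ((F.P Kt).d * (((F.P Kt).L ^ i - 1) / 2) + 1)) + 1 +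
      (3 * ((F.P Kt).d * (((F.P Kt).L - 1) / 2)) + 5) * (F.P Kt).L ^ k < (F.P Kt).sitesPerDir 0)
    -- the region-normalised datum and the minimiser
    {ρn : ℝ} (hρn : 0 ≤ ρn)
    (W : GaugeField (F.P Kt) k SU2) (𝒞 : Set (PBond (F.P Kt) k)) (hD : ∀ c ∈ 𝒞, dist1 (W c) ≤ ρn)
    {U₀ : GaugeField (F.P Kt) 0 SU2}
    (hmin : IsMinimizerB (Node00.avOfRecord F 2 Kt) (Node00.regMSCoPOfRecord F 2 ν Kt k (maxDomT ν.M₁ Z)) (lamBondsSeq (maxDomT ν.M₁ Z) k)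
      (avgFamily (Node00.avOfRecord F 2 Kt) (qsstarGIter0 k W)) U₀)
    -- geometry of the neighbourhood (dag-n12-w6's letters, verbatim)
    (N : Set (PBond (F.P Kt) 0))
    (hGN : ∀ b ∈ N, (b.src ∉ maxDomT ν.M₁ Z 1 ∨ b.tgt ∉ maxDomT ν.M₁ Z 1) → blockIter k b.tgt ≠ blockIter k b.src →
      (⟨blockIter k b.src, b.dir⟩ : PBond (F.P Kt) k) ∈ 𝒞)
    (hN1 : ∀ p : Plaq (F.P Kt) 0, ((⟨p.src, p.μ⟩ : PBond (F.P Kt) 0) ∈ {b : PBond (F.P Kt) 0 | b.src ∈ maxDomT ν.M₁ Z 1} ∨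
        (⟨p.src.shift p.μ, p.ν⟩ : PBond (F.P Kt) 0) ∈ {b : PBond (F.P Kt) 0 | b.src ∈ maxDomT ν.M₁ Z 1} ∨
        (⟨p.src.shift p.ν, p.μ⟩ : PBond (F.P Kt) 0) ∈ {b : PBond (F.P Kt) 0 | b.src ∈ maxDomT ν.M₁ Z 1} ∨
        (⟨p.src, p.ν⟩ : PBond (F.P Kt) 0) ∈ {b : PBond (F.P Kt) 0 | b.src ∈ maxDomT ν.M₁ Z 1}) →
      (⟨p.src, p.μ⟩ : PBond (F.P Kt) 0) ∈ N ∧ (⟨p.src.shift p.μ, p.ν⟩ : PBond (F.P Kt) 0) ∈ N ∧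
        (⟨p.src.shift p.ν, p.μ⟩ : PBond (F.P Kt) 0) ∈ N ∧ (⟨p.src, p.ν⟩ : PBond (F.P Kt) 0) ∈ N)
    -- DISPLAYED: ONE graded root-free plaquette letter for the minimiser, LEVEL FORM, on the bonds inside the ONE-LAYER EXTENSION `Ωx(Z)` of `Ω₁(Z)` (LOCATED-2)
    {S : Set (Plaq (F.P Kt) 0)} {εP : ℝ} (hεP : 0 ≤ εP) (hP : PlaqSmallOn S εP U₀)
    (hSΩ : ∀ b : PBond (F.P Kt) 0,
      b.src ∈ {z : Site (F.P Kt) 0 | ∃ b' : PBond (F.P Kt) 0, (b'.src ∈ maxDomT ν.M₁ Z 1 ∨ b'.tgt ∈ maxDomT ν.M₁ Z 1) ∧ (z = b'.src ∨ z = b'.tgt)} →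
      b.tgt ∈ {z : Site (F.P Kt) 0 | ∃ b' : PBond (F.P Kt) 0, (b'.src ∈ maxDomT ν.M₁ Z 1 ∨ b'.tgt ∈ maxDomT ν.M₁ Z 1) ∧ (z = b'.src ∨ z = b'.tgt)} →
      ∀ J J' : ℕ, iterBlockOf J b.src ∈ (Bj ν.M₁ Z k : DetSet (F.P Kt)) J → iterBlockOf J' b.tgt ∈ (Bj ν.M₁ Z k : DetSet (F.P Kt)) J' →
      (boxPlaqs
          (fun κ => ((b.src κ).val : ℤ) -
            (((2 * max (∑ i ∈ Finset.range (J + 1), ((F.P Kt).d * (((F.P Kt).L ^ i - 1) / 2) + 1))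
                  (∑ i ∈ Finset.range (J' + 1), ((F.P Kt).d * (((F.P Kt).L ^ i - 1) / 2) + 1)) + 1 +
                (3 * ((F.P Kt).d * (((F.P Kt).L - 1) / 2)) + 5) * (F.P Kt).L ^ min (J + 1) k) +
              ∑ i ∈ Finset.range (J + 1), ((F.P Kt).d * (((F.P Kt).L ^ i - 1) / 2) + 1) : ℕ) : ℤ))
          (fun κ => ((b.src κ).val : ℤ) +
            (((2 * max (∑ i ∈ Finset.range (J + 1), ((F.P Kt).d * (((F.P Kt).L ^ i - 1) / 2) + 1))
                  (∑ i ∈ Finset.range (J' + 1), ((F.P Kt).d * (((F.P Kt).L ^ i - 1) / 2) + 1)) + 1 +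
                (3 * ((F.P Kt).d * (((F.P Kt).L - 1) / 2)) + 5) * (F.P Kt).L ^ min (J + 1) k) +
              ∑ i ∈ Finset.range (J + 1), ((F.P Kt).d * (((F.P Kt).L ^ i - 1) / 2) + 1) : ℕ) : ℤ) + 2) : Set (Plaq (F.P Kt) 0)) ⊆ S)
    -- DISPLAYED: the plaquette letter on the iterated averages near the member segments, with its budgets
    (a θ : ℕ → ℝ) (hθ0 : 0 ≤ θ 0) (ha0 : ∀ j, 0 ≤ a j)
    (haN : ∀ j < k, (((((F.P Kt).d + 2) * (F.P Kt).L : ℕ) : ℝ) ^ 2 / 4) * a j < deltaSU (Fin 2))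
    (hθ : ∀ j, 6 * ((((((F.P Kt).d + 2) * (F.P Kt).L : ℕ) : ℝ) ^ 2 / 4) * a j) + (F.P Kt).L * θ j ≤ θ (j + 1))
    (ha : ∀ i ≤ k, ∀ c ∈ lamBondsSeq (maxDomT ν.M₁ Z) k i, ∀ j < i, ∀ c' : PBond (F.P Kt) (j + 1), c'.dir = c.dir →
      (∃ s < (F.P Kt).L ^ i, embIter (j + 1) c'.src = (fun z : Site (F.P Kt) 0 => z.shift c.dir)^[s] (embIter i c.src)) →
      ∀ q : Plaq (F.P Kt) j, (blockOf q.src = c'.src.unshift c'.dir ∨ blockOf q.src = c'.src ∨ blockOf q.src = c'.tgt) →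
        dist1 (GaugeField.plaqHol (avgFamily (Node00.avOfRecord F 2 Kt) U₀ j) q) < a j)
    -- DISPLAYED: the datum letter at the members (levels `≤ k`)
    {δ₁ : ℝ} (hδ0 : 0 ≤ δ₁) (hWj : ∀ i ≤ k, ∀ c ∈ lamBondsSeq (maxDomT ν.M₁ Z) k i, dist1 (avgFamily (Node00.avOfRecord F 2 Kt) (qsstarGIter0 k W) i c) ≤ δ₁) :
    ∃ σ : GaugeTransf (F.P Kt) 0 SU2,
      (∀ j, j ≤ k → ∀ b ∈ lamBondsSeq (maxDomT ν.M₁ Z) k j, toMS σ j b.src = 1 ∧ toMS σ j b.tgt = 1) ∧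
        (∀ p : Plaq (F.P Kt) 0, ((⟨p.src, p.μ⟩ : PBond (F.P Kt) 0) ∈ {b : PBond (F.P Kt) 0 | b.src ∈ maxDomT ν.M₁ Z 1} ∨
            (⟨p.src.shift p.μ, p.ν⟩ : PBond (F.P Kt) 0) ∈ {b : PBond (F.P Kt) 0 | b.src ∈ maxDomT ν.M₁ Z 1} ∨
            (⟨p.src.shift p.ν, p.μ⟩ : PBond (F.P Kt) 0) ∈ {b : PBond (F.P Kt) 0 | b.src ∈ maxDomT ν.M₁ Z 1} ∨
            (⟨p.src, p.ν⟩ : PBond (F.P Kt) 0) ∈ {b : PBond (F.P Kt) 0 | b.src ∈ maxDomT ν.M₁ Z 1}) →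
          ‖((gaugeAct σ U₀ ⟨p.src, p.μ⟩ : SU2) : Matrix (Fin 2) (Fin 2) ℂ) - 1‖ ≤
              max ρn ((((2 * (∑ i ∈ Finset.range (k + 1), ((F.P Kt).d * (((F.P Kt).L ^ i - 1) / 2) + 1)) + 1 +
                  (3 * ((F.P Kt).d * (((F.P Kt).L - 1) / 2)) + 5) * (F.P Kt).L ^ k : ℕ) : ℝ)) ^ 2 / 4 * εP +
                ((3 * ((F.P Kt).d * (((F.P Kt).L - 1) / 2)) + 5 : ℕ) : ℝ) * θ k + ((3 * ((F.P Kt).d * (((F.P Kt).L - 1) / 2)) + 5 : ℕ) : ℝ) * δ₁) ∧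
            ‖((gaugeAct σ U₀ ⟨p.src.shift p.μ, p.ν⟩ : SU2) : Matrix (Fin 2) (Fin 2) ℂ) - 1‖ ≤
              max ρn ((((2 * (∑ i ∈ Finset.range (k + 1), ((F.P Kt).d * (((F.P Kt).L ^ i - 1) / 2) + 1)) + 1 +
                  (3 * ((F.P Kt).d * (((F.P Kt).L - 1) / 2)) + 5) * (F.P Kt).L ^ k : ℕ) : ℝ)) ^ 2 / 4 * εP +
                ((3 * ((F.P Kt).d * (((F.P Kt).L - 1) / 2)) + 5 : ℕ) : ℝ) * θ k + ((3 * ((F.P Kt).d * (((F.P Kt).L - 1) / 2)) + 5 : ℕ) : ℝ) * δ₁) ∧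
            ‖((gaugeAct σ U₀ ⟨p.src.shift p.ν, p.μ⟩ : SU2) : Matrix (Fin 2) (Fin 2) ℂ) - 1‖ ≤
              max ρn ((((2 * (∑ i ∈ Finset.range (k + 1), ((F.P Kt).d * (((F.P Kt).L ^ i - 1) / 2) + 1)) + 1 +
                  (3 * ((F.P Kt).d * (((F.P Kt).L - 1) / 2)) + 5) * (F.P Kt).L ^ k : ℕ) : ℝ)) ^ 2 / 4 * εP +
                ((3 * ((F.P Kt).d * (((F.P Kt).L - 1) / 2)) + 5 : ℕ) : ℝ) * θ k + ((3 * ((F.P Kt).d * (((F.P Kt).L - 1) / 2)) + 5 : ℕ) : ℝ) * δ₁) ∧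
            ‖((gaugeAct σ U₀ ⟨p.src, p.ν⟩ : SU2) : Matrix (Fin 2) (Fin 2) ℂ) - 1‖ ≤
              max ρn ((((2 * (∑ i ∈ Finset.range (k + 1), ((F.P Kt).d * (((F.P Kt).L ^ i - 1) / 2) + 1)) + 1 +
                  (3 * ((F.P Kt).d * (((F.P Kt).L - 1) / 2)) + 5) * (F.P Kt).L ^ k : ℕ) : ℝ)) ^ 2 / 4 * εP +
                ((3 * ((F.P Kt).d * (((F.P Kt).L - 1) / 2)) + 5 : ℕ) : ℝ) * θ k + ((3 * ((F.P Kt).d * (((F.P Kt).L - 1) / 2)) + 5 : ℕ) : ℝ) * δ₁)) ∧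
        (∀ b ∈ N,
          ‖((gaugeAct σ U₀ b : SU2) : Matrix (Fin 2) (Fin 2) ℂ) - 1‖ ≤
              max ρn ((((2 * (∑ i ∈ Finset.range (k + 1), ((F.P Kt).d * (((F.P Kt).L ^ i - 1) / 2) + 1)) + 1 +
                  (3 * ((F.P Kt).d * (((F.P Kt).L - 1) / 2)) + 5) * (F.P Kt).L ^ k : ℕ) : ℝ)) ^ 2 / 4 * εP +
                ((3 * ((F.P Kt).d * (((F.P Kt).L - 1) / 2)) + 5 : ℕ) : ℝ) * θ k + ((3 * ((F.P Kt).d * (((F.P Kt).L - 1) / 2)) + 5 : ℕ) : ℝ) * δ₁)) := by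
  classical
  have hk1 : 1 ≤ k := hk0
  have hM : 1 ≤ ν.M₁ := by omega
  -- the rooted tower forest at PRINT roots (this seat's `…N12TowerForestLam`): roots = the `Γ`-centres, no face layer
  obtain ⟨path, root, -, hF2, -, -, hw, hlevel, hcov, hcentre⟩ :=
    exists_towerForest_rooted_lamBondsSeq (P := F.P Kt) (M₁ := ν.M₁) (Z := Z) hk hk1 hM hdiv
  -- the `Γ`-level of a site (a choice; unique anyway) and the graded budgets
  have hJ : ∀ x : Site (F.P Kt) 0, Classical.choose (hcov x) ≤ k ∧ iterBlockOf (Classical.choose (hcov x)) x ∈ (Bj ν.M₁ Z k : DetSet (F.P Kt)) (Classical.choose (hcov x)) :=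
    fun x => ⟨(Classical.choose_spec (hcov x)).1, (Classical.choose_spec (hcov x)).2.1⟩
  set ℓs : Site (F.P Kt) 0 → ℕ := fun x => ∑ i ∈ Finset.range (Classical.choose (hcov x) + 1), ((F.P Kt).d * (((F.P Kt).L ^ i - 1) / 2) + 1) with hℓs_def
  set ℓb : PBond (F.P Kt) 0 → ℕ := fun b => (3 * ((F.P Kt).d * (((F.P Kt).L - 1) / 2)) + 5) * (F.P Kt).L ^ min (Classical.choose (hcov b.src) + 1) k with hℓb_def
  -- the centre of the `Γ`-level block is a print root, so (LEN) at that level bounds the word — at EVERY site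
  have hℓs : ∀ x ∈ {z : Site (F.P Kt) 0 | ∃ b' : PBond (F.P Kt) 0, (b'.src ∈ maxDomT ν.M₁ Z 1 ∨ b'.tgt ∈ maxDomT ν.M₁ Z 1) ∧ (z = b'.src ∨ z = b'.tgt)},
      (path x).length ≤ ℓs x := fun x _ => (hlevel x _ (hJ x).1 (centre_mem_rootSetLam hM hdiv hk (hJ x).2)).2.1
  have hcapS : ∀ x ∈ {z : Site (F.P Kt) 0 | ∃ b' : PBond (F.P Kt) 0, (b'.src ∈ maxDomT ν.M₁ Z 1 ∨ b'.tgt ∈ maxDomT ν.M₁ Z 1) ∧ (z = b'.src ∨ z = b'.tgt)},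
      ℓs x ≤ ∑ i ∈ Finset.range (k + 1), ((F.P Kt).d * (((F.P Kt).L ^ i - 1) / 2) + 1) := fun x _ => by
    show (∑ i ∈ Finset.range (Classical.choose (hcov x) + 1), ((F.P Kt).d * (((F.P Kt).L ^ i - 1) / 2) + 1)) ≤ _
    apply Finset.sum_le_sum_of_subset
    intro i hi
    have hJx := (hJ x).1
    simp only [Finset.mem_range] at hi ⊢
    omega
  have hcapB : ∀ b : PBond (F.P Kt) 0, b.src ∈ {z : Site (F.P Kt) 0 | ∃ b' : PBond (F.P Kt) 0, (b'.src ∈ maxDomT ν.M₁ Z 1 ∨ b'.tgt ∈ maxDomT ν.M₁ Z 1) ∧ (z = b'.src ∨ z = b'.tgt)} → b.tgt ∈ {z : Site (F.P Kt) 0 | ∃ b' : PBond (F.P Kt) 0, (b'.src ∈ maxDomT ν.M₁ Z 1 ∨ b'.tgt ∈ maxDomT ν.M₁ Z 1) ∧ (z = b'.src ∨ z = b'.tgt)} →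
      ℓb b ≤ (3 * ((F.P Kt).d * (((F.P Kt).L - 1) / 2)) + 5) * (F.P Kt).L ^ k := fun b _ _ =>
    Nat.mul_le_mul_left _ (Nat.pow_le_pow_right (F.P Kt).L_pos (min_le_right _ _))
  -- uniform error budgets
  have hκ0 : ∀ j, 0 ≤ 6 * ((((((F.P Kt).d + 2) * (F.P Kt).L : ℕ) : ℝ) ^ 2 / 4) * a j) := fun j => by
    have h1 : (0 : ℝ) ≤ (((((F.P Kt).d + 2) * (F.P Kt).L : ℕ) : ℝ) ^ 2 / 4) := by positivity
    have := mul_nonneg h1 (ha0 j)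
    linarith
  have hθmono : ∀ i j, i ≤ j → θ i ≤ θ j := fun i j hij => (theta_mono_of_nonneg _ θ hθ0 hκ0 hθ hij).2
  have hθk0 : 0 ≤ θ k := hθ0.trans (hθmono 0 k (Nat.zero_le k))
  have hm0 : (0 : ℝ) ≤ ((3 * ((F.P Kt).d * (((F.P Kt).L - 1) / 2)) + 5 : ℕ) : ℝ) := Nat.cast_nonneg _
  have hm1 : (1 : ℝ) ≤ ((3 * ((F.P Kt).d * (((F.P Kt).L - 1) / 2)) + 5 : ℕ) : ℝ) := by exact_mod_cast (show 1 ≤ 3 * ((F.P Kt).d * (((F.P Kt).L - 1) / 2)) + 5 by omega)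
  -- print's level-`0` datum contains every bond with BOTH end-points off `Ω₁(Z)` ([II] (2.3) at `Z`'s maximal sequence)
  have h𝔅0 : ∀ b : PBond (F.P Kt) 0, b.src ∉ maxDomT ν.M₁ Z 1 → b.tgt ∉ maxDomT ν.M₁ Z 1 → b ∈ lamBondsSeq (maxDomT ν.M₁ Z) k 0 := fun b hs ht =>
    mem_lamBondsSeq_maxDomT_of_embIter_not_mem hM Z hk hdiv (Or.inl (by rw [Bj_zero hk0]; exact hs)) (fun _ => hs) (fun _ => ht)
  -- the root-transporter letter `hT` on the bonds inside `Ωx(Z)`: touching bonds by the graded chains (crossing bonds through the outward connector, LOCATED-2),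
  -- bonds with both end-points off `Ω₁(Z)` are pinned print members of level `0` — the one-letter word along the bond itself
  have hT : ∀ b : PBond (F.P Kt) 0,
      b.src ∈ {z : Site (F.P Kt) 0 | ∃ b' : PBond (F.P Kt) 0, (b'.src ∈ maxDomT ν.M₁ Z 1 ∨ b'.tgt ∈ maxDomT ν.M₁ Z 1) ∧ (z = b'.src ∨ z = b'.tgt)} →
      b.tgt ∈ {z : Site (F.P Kt) 0 | ∃ b' : PBond (F.P Kt) 0, (b'.src ∈ maxDomT ν.M₁ Z 1 ∨ b'.tgt ∈ maxDomT ν.M₁ Z 1) ∧ (z = b'.src ∨ z = b'.tgt)} →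
      root b.src ≠ root b.tgt →
      ∃ (Ωw : List (Letter (F.P Kt).d)) (g : SU2), walkEnd (root b.src) Ωw = root b.tgt ∧ Ωw.length ≤ ℓb b ∧
        dist1 (holAt U₀ (walk (root b.src) Ωw) * g⁻¹) ≤ ((3 * ((F.P Kt).d * (((F.P Kt).L - 1) / 2)) + 5 : ℕ) : ℝ) * θ k ∧
        dist1 g ≤ ((3 * ((F.P Kt).d * (((F.P Kt).L - 1) / 2)) + 5 : ℕ) : ℝ) * δ₁ := by
    intro b _ _ hne
    by_cases hb : b.src ∈ maxDomT ν.M₁ Z 1 ∨ b.tgt ∈ maxDomT ν.M₁ Z 1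
    · obtain ⟨Ωw, g, hwe, hl, hH, hg⟩ := rootTransporter_atRecord_lamBondsSeq_graded_touching_of_plaqSmall ν Kt hk1 hk hM2 hdiv Z root hcentre W hmin a θ hθ0 ha0 haN hθ ha hWj
        b hb hne _ (hJ b.src).2
      exact ⟨Ωw, g, hwe, hl, hH.trans (mul_le_mul_of_nonneg_left (hθmono _ _ (min_le_right _ _)) hm0), hg⟩
    · obtain ⟨hs0, ht0⟩ := not_or.mp hb
      have hmem0 : b ∈ lamBondsSeq (maxDomT ν.M₁ Z) k 0 := h𝔅0 b hs0 ht0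
      have hr0 : ∀ z : Site (F.P Kt) 0, z ∉ maxDomT ν.M₁ Z 1 → root z = z := fun z hz =>
        hcentre z 0 (by rw [Bj_zero hk0]; exact hz)
      rw [hr0 b.src hs0, hr0 b.tgt ht0]
      have hhol : holAt U₀ (walk b.src [(b.dir, true)]) = U₀ b := by
        simp [walk, holAt_cons, holAt_nil]
      refine ⟨[(b.dir, true)], U₀ b, rfl, ?_, ?_, ?_⟩
      · show 1 ≤ (3 * ((F.P Kt).d * (((F.P Kt).L - 1) / 2)) + 5) * (F.P Kt).L ^ min (Classical.choose (hcov b.src) + 1) k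
        exact Nat.one_le_iff_ne_zero.2 (Nat.mul_ne_zero (by omega) (Nat.pos_iff_ne_zero.1 (Nat.pow_pos (F.P Kt).L_pos)))
      · rw [hhol, mul_inv_cancel, GaugeGroup.dist1_one]
        exact mul_nonneg hm0 hθk0
      · -- the datum letter at the pinned level-`0` member `b` (constraint (2.12) on print's bonds)
        have hagree : avgFamily (Node00.avOfRecord F 2 Kt) U₀ 0 b = avgFamily (Node00.avOfRecord F 2 Kt) (qsstarGIter0 k W) 0 b := hmin.2.1 0 b hmem0
        have h1 : dist1 (avgFamily (Node00.avOfRecord F 2 Kt) U₀ 0 b) ≤ δ₁ := by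
          rw [hagree]; exact hWj 0 (Nat.zero_le k) b hmem0
        have h1' : dist1 (U₀ b) ≤ δ₁ := by simpa [avgFamily, Averaging.iter] using h1
        calc dist1 (U₀ b) ≤ δ₁ := h1'
          _ = 1 * δ₁ := (one_mul _).symm
          _ ≤ ((3 * ((F.P Kt).d * (((F.P Kt).L - 1) / 2)) + 5 : ℕ) : ℝ) * δ₁ := mul_le_mul_of_nonneg_right hm1 hδ0
  -- the plug-in letters of the lane's bond-datum producer
  have hΩx : ∀ b : PBond (F.P Kt) 0, (b.src ∈ maxDomT ν.M₁ Z 1 ∨ b.tgt ∈ maxDomT ν.M₁ Z 1) →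
      b.src ∈ {z : Site (F.P Kt) 0 | ∃ b' : PBond (F.P Kt) 0, (b'.src ∈ maxDomT ν.M₁ Z 1 ∨ b'.tgt ∈ maxDomT ν.M₁ Z 1) ∧ (z = b'.src ∨ z = b'.tgt)} ∧
      b.tgt ∈ {z : Site (F.P Kt) 0 | ∃ b' : PBond (F.P Kt) 0, (b'.src ∈ maxDomT ν.M₁ Z 1 ∨ b'.tgt ∈ maxDomT ν.M₁ Z 1) ∧ (z = b'.src ∨ z = b'.tgt)} := fun b h => ⟨⟨b, h, Or.inl rfl⟩, ⟨b, h, Or.inr rfl⟩⟩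
  have hcov' : ∀ z : Site (F.P Kt) 0, ∃ J, J ≤ k ∧ ∃ c ∈ lamBondsSeq (maxDomT ν.M₁ Z) k J, (iterBlockOf J z = c.src ∨ iterBlockOf J z = c.tgt) := fun z => by
    obtain ⟨J, hJk, -, c, hc, h⟩ := hcov z
    exact ⟨J, hJk, c, hc, h⟩
  have hGN' : ∀ b ∈ N, b.src ∉ maxDomT ν.M₁ Z 1 → b.tgt ∉ maxDomT ν.M₁ Z 1 → blockIter k b.tgt ≠ blockIter k b.src →
      (⟨blockIter k b.src, b.dir⟩ : PBond (F.P Kt) k) ∈ 𝒞 := fun b hb hs _ hne => hGN b hb (Or.inl hs) hne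
  have hSΩ' : ∀ b : PBond (F.P Kt) 0,
      b.src ∈ {z : Site (F.P Kt) 0 | ∃ b' : PBond (F.P Kt) 0, (b'.src ∈ maxDomT ν.M₁ Z 1 ∨ b'.tgt ∈ maxDomT ν.M₁ Z 1) ∧ (z = b'.src ∨ z = b'.tgt)} →
      b.tgt ∈ {z : Site (F.P Kt) 0 | ∃ b' : PBond (F.P Kt) 0, (b'.src ∈ maxDomT ν.M₁ Z 1 ∨ b'.tgt ∈ maxDomT ν.M₁ Z 1) ∧ (z = b'.src ∨ z = b'.tgt)} →
      (boxPlaqs (fun κ => ((b.src κ).val : ℤ) - (((2 * max (ℓs b.src) (ℓs b.tgt) + 1 + ℓb b) + ℓs b.src : ℕ) : ℤ))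
          (fun κ => ((b.src κ).val : ℤ) + (((2 * max (ℓs b.src) (ℓs b.tgt) + 1 + ℓb b) + ℓs b.src : ℕ) : ℤ) + 2) : Set (Plaq (F.P Kt) 0)) ⊆ S :=
    fun b hbs hbt => hSΩ b hbs hbt _ _ (hJ b.src).2 (hJ b.tgt).2
  exact exists_gaugeLetterLoc_atRecord_of_forestPackage ν Kt hk Z (lamBondsSeq (maxDomT ν.M₁ Z) k) h𝔅0 path root hF2 (fun x => ⟨(hw x).2.1, (hw x).2.2⟩) hlevel hcov'
    {z : Site (F.P Kt) 0 | ∃ b' : PBond (F.P Kt) 0, (b'.src ∈ maxDomT ν.M₁ Z 1 ∨ b'.tgt ∈ maxDomT ν.M₁ Z 1) ∧ (z = b'.src ∨ z = b'.tgt)}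
    hΩx ℓs hℓs ℓb hcapS hcapB hN hρn W 𝒞 hD hmin N hGN' hN1 hεP hP hSΩ' (mul_nonneg hm0 hθk0) (mul_nonneg hm0 hδ0) hT

end Summit.QuantumFields.YangMills.BalabanUVNodes.N12GaugeLetterLocAtRecordLam

end
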